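import Mathlib
import HarnessLib
import Literature.NumberTheory.Sieve.LinearEquationsInPrimes

/-!
# Route `TelescopingWindows` (rev 1/2, guard G2 = lattice shifts) — definitions

Route-independent vocabulary (D-0009) for the lattice-shift dictionary / T15 certificate
(`Theorems/TelescopingWindowsLatticeShift.lean`) and the necessity/exactness package
(`Theorems/TelescopingWindowsLatticeNecessity.lean`) of decomp-parity node G1.3 «TelescopingWindows» as REPAIRED by
lens-4 g6 (route-Parity-TelescopingWindows rev 1 commit 3db47418b75b, items WindowMeanStep = stmt-Parity-31164,
ShiftLocalConstancyGivenQ = stmt-Parity-31165; critic CLEARED HOME/STATUS.md l.330, CRITIC-LEDGER row 65, hand = P1).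
The born items inline these objects textually; here they get names: the signed Hardy–Littlewood error `hlError`, the
constant-term shift `shiftConst Ψ i j = Ψ^{(i,j)}`, the window length `windowLen θ N = ⌊N^θ⌋`, the
obstruction-preserving stride modulus `strideMod t L = primorial (max t L)` and the lattice window `latticeWindow`.
Cell kernel: `HOME/decomp-parity-lens-4/g6/TelescopingWindowsLattice.lean` (@39b0e93f).  Definitions only; no statements.
-/

namespace Summit.Parity.GeneralizedHardyLittlewood.TelescopingWindowsLatticeShift

open Finset
open Literature.NumberTheory.Sieve hiding GeneralizedHardyLittlewood

noncomputable section

/-- The Hardy–Littlewood error of one datum: `E(Ψ,K,N) = ∑_{n∈K∩ℤ^d} ∏ Λ(ψ_i(n)) − β_∞(Ψ,K)·𝔖(Ψ)`. -/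
def hlError {d t : ℕ} (Ψ : Fin t → AffLinForm d) (K : Set (Fin d → ℝ)) (N : ℕ) : ℝ :=
  vonMangoldtSum Ψ K N - archFactor Ψ K * singularProduct Ψ

/-- `Ψ^{(i,j)}`: the system `Ψ` with the constant term of the `i`-th form raised by `j`. -/
def shiftConst {d t : ℕ} (Ψ : Fin t → AffLinForm d) (i : Fin t) (j : ℤ) : Fin t → AffLinForm d :=
  Function.update Ψ i ⟨(Ψ i).coeff, (Ψ i).const + j⟩

/-- Window length `H = ⌊N^θ⌋`. -/
def windowLen (θ : ℝ) (N : ℕ) : ℕ := ⌊(N : ℝ) ^ θ⌋₊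

/-- The obstruction-preserving stride modulus `P(t,L) = primorial (max t L)` (guard G2). -/
def strideMod (t L : ℕ) : ℕ := primorial (max t L)

open scoped Classical in
/-- The lattice window: `0 ≤ j < ⌊N^θ⌋`, `P ∣ j`, `Ψ^{(i,j)}` non-degenerate. -/
def latticeWindow (θ : ℝ) (P : ℕ) {d t : ℕ} (Ψ : Fin t → AffLinForm d) (i : Fin t) (N : ℕ) :
    Finset ℕ :=
  (Finset.range (windowLen θ N)).filter
    (fun j : ℕ => P ∣ j ∧ IsNondegenerateSystem (shiftConst Ψ i (j : ℤ)))

end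

end Summit.Parity.GeneralizedHardyLittlewood.TelescopingWindowsLatticeShift
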